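import Summits.ResolutionOfSingularities.ResolutionOfSingularities.Theorems.EquisingularLiftEquisingularLiftNatLiftCoreLocal
import Mathlib.Order.Zorn
import HarnessLib

/-!
# [OURS · L1 W4.5(b) · EL♮] LIFT-50 LOCAL CORE, part 3: the WEAK CONVERSE over an arbitrary local ring — `ϖ ∉ 𝔪·I` alone gives a
# (not necessarily regular) lift ideal `J ≤ I` with `ϖ ∉ J`, `J + (ϖ) = I` (crux `EquisingularLiftNat` = stmt-ResolutionOfSingularities-20038;
# PARENT ≥ 4 band / kill test #50; object (ε); closes res-L1-w45b-idea-1's stub `stub_exists_liftIdeal_of_not_degenerate` of line `nose-shade`)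

HONEST FRAMING. OURS (cell res-hironaka, crux chain w45b, slot W4.5(b)); NOT a statement of any manuscript; replaces the role of NOTHING
in the manuscript; AI-written, AI review is weaker than expert review. Helper `--supports stmt-ResolutionOfSingularities-20038 --as helper`.
Continues `…NatLiftCoreLocal` (p569735: necessity `LiftCore.not_mem_mul_of_sup_span_eq`) and `…NatLiftCoreLocalHypersurface` (p570814: the
REGULAR lift in a regular local ring). res-L1-w45b-idea-1 g14's typed line `nose-shade` (Sketch-NoseShade.lean 1c93d2370b857841, §17.2′) left
one stub, the weak converse «`ϖ ∈ I`, `ϖ ∉ 𝔪·I`, `I` f.g. ⟹ ∃ J, J + (ϖ) = I ∧ ϖ ∉ J» (its `LiftIdeal ϖ I J`); this file proves it — WITHOUT the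
finiteness hypothesis — by Zorn: among the ideals `J ≤ I` with `𝔪·I ≤ J` and `ϖ ∉ J` (non-empty: `𝔪·I` itself) take a maximal one; if some
`x ∈ I` escaped `J + (ϖ)`, maximality would put `ϖ = j + a·x` in `J + (x)`, and then either `a` is a unit (so `x ∈ J + (ϖ)`) or `a·x ∈ 𝔪·I ≤ J`
(so `ϖ ∈ J`) — contradiction either way.

* `exists_flat_lift_of_not_mem_mul` — the weak converse (any local ring, any ideal).
* `exists_flat_lift_iff` — with part 1: for `I` finitely generated, `(∃ J ≤ I, ϖ ∉ J ∧ J + (ϖ) = I) ⟺ ϖ ∉ 𝔪·I`.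

Geometric reading (LIFT50-CORE §1): `ϖ ∉ 𝔪_x I_{X,x}` ⟺ `X ⊂ V(ϖ)` is, near `x`, the special fibre of SOME `O`-torsion-free-at-`ϖ` closed `X̃ = V(J)`
of the ambient (no regularity asked); the regular version needs `X` of embedded hypersurface type (part 2). Memo `L/res-L1-w45b-lead-1/LIFT50-CORE.md`.
References: [folklore] (Zorn / Nakayama).
-/

set_option linter.dupNamespace false -- mandated namespace `Summit.<Summit>.<Problem>` of this single-conjunct summit

universe u

open IsLocalRing

namespace Summit.ResolutionOfSingularities.ResolutionOfSingularities.Cruxes.EquisingularLiftNat.Sections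

namespace LiftCore

variable {A : Type u} [CommRing A] [IsLocalRing A]

/-- **Weak converse (any local ring).** If `ϖ ∈ I` and `ϖ ∉ 𝔪·I` then there is an ideal `J ≤ I` with `ϖ ∉ J` and `J + (ϖ) = I` — a flat
(torsion-free at `ϖ` when `A ⧸ J` is a domain; here only `ϖ ∉ J` is asserted) local lift of `X = V(I)`, not necessarily regular. Proof by Zorn over
`{J ≤ I | 𝔪·I ≤ J, ϖ ∉ J} ∋ 𝔪·I`. Closes res-L1-w45b-idea-1's `stub_exists_liftIdeal_of_not_degenerate` (which assumed `I` f.g.). OURS. [folklore] -/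
theorem exists_flat_lift_of_not_mem_mul {I : Ideal A} {ϖ : A} (hϖI : ϖ ∈ I) (hϖ : ϖ ∉ maximalIdeal A * I) :
    ∃ J ≤ I, ϖ ∉ J ∧ J ⊔ Ideal.span {ϖ} = I := by
  classical
  -- the Zorn family
  let S : Set (Ideal A) := {J | J ≤ I ∧ maximalIdeal A * I ≤ J ∧ ϖ ∉ J}
  have hS₀ : maximalIdeal A * I ∈ S := ⟨Ideal.mul_le_left, le_rfl, hϖ⟩
  -- chains have upper bounds (the union)
  have hchain : ∀ c ⊆ S, IsChain (· ≤ ·) c → ∀ y ∈ c, ∃ ub ∈ S, ∀ z ∈ c, z ≤ ub := by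
    intro c hcS hc y hy
    refine ⟨sSup c, ⟨?_, ?_, ?_⟩, fun z hz => le_sSup hz⟩
    · exact sSup_le fun z hz => (hcS hz).1
    · exact (hcS hy).2.1.trans (le_sSup hy)
    · intro hmem
      have hdir : DirectedOn (· ≤ ·) c := hc.directedOn
      obtain ⟨z, hz, hϖz⟩ := (Submodule.mem_sSup_of_directed ⟨y, hy⟩ hdir).mp hmem
      exact (hcS hz).2.2 hϖz
  obtain ⟨J, -, hJmax⟩ := zorn_le_nonempty₀ S hchain (maximalIdeal A * I) hS₀
  obtain ⟨hJI, hmJ, hϖJ⟩ := hJmax.prop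
  refine ⟨J, hJI, hϖJ, ?_⟩
  apply le_antisymm (sup_le hJI ((Ideal.span_singleton_le_iff_mem _).mpr hϖI))
  -- if some `x ∈ I` escaped `J + (ϖ)`, `J + (x)` would be a larger member of the family
  intro x hxI
  by_contra hx
  have hJx : ¬ (J ⊔ Ideal.span {x} ∈ S) := by
    intro hmemS
    have hle : J ⊔ Ideal.span {x} ≤ J := hJmax.le_of_ge hmemS le_sup_left
    exact hx (Ideal.mem_sup_left (hle (Ideal.mem_sup_right (Ideal.mem_span_singleton_self x))))
  -- so `ϖ ∈ J + (x)`
  have hϖJx : ϖ ∈ J ⊔ Ideal.span {x} := by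
    by_contra hnot
    exact hJx ⟨sup_le hJI ((Ideal.span_singleton_le_iff_mem _).mpr hxI), hmJ.trans le_sup_left, hnot⟩
  obtain ⟨j, hj, z, hz, hjz⟩ := Submodule.mem_sup.mp hϖJx
  obtain ⟨a, rfl⟩ := Ideal.mem_span_singleton'.mp hz
  by_cases ha : a ∈ maximalIdeal A
  · -- `a·x ∈ 𝔪·I ≤ J`, so `ϖ ∈ J`
    apply hϖJ
    rw [← hjz]
    exact Ideal.add_mem _ hj (hmJ (Ideal.mul_mem_mul ha hxI))
  · -- `a` is a unit, so `x ∈ J + (ϖ)`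
    have hau : IsUnit a := (IsLocalRing.notMem_maximalIdeal).mp ha
    apply hx
    have h1 : a * x ∈ J ⊔ Ideal.span {ϖ} := by
      have : a * x = ϖ - j := by rw [← hjz]; ring
      rw [this]
      exact Ideal.sub_mem _ (Ideal.mem_sup_right (Ideal.mem_span_singleton_self ϖ)) (Ideal.mem_sup_left hj)
    have : x = ↑hau.unit⁻¹ * (a * x) := by rw [← mul_assoc, IsUnit.val_inv_mul, one_mul]
    rw [this]
    exact Ideal.mul_mem_left _ _ h1

/-- **The weak criterion (iff), any Noetherian local ring**: a lift ideal exists ⟺ `ϖ ∉ 𝔪·I` (necessity = part 1,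
`LiftCore.not_mem_mul_of_exists_lift`, Nakayama; sufficiency = Zorn above). OURS. [folklore] -/
theorem exists_flat_lift_iff [IsNoetherianRing A] {I : Ideal A} {ϖ : A} (hϖI : ϖ ∈ I) :
    (∃ J ≤ I, ϖ ∉ J ∧ J ⊔ Ideal.span {ϖ} = I) ↔ ϖ ∉ maximalIdeal A * I :=
  ⟨fun h => not_mem_mul_of_exists_lift h, fun h => exists_flat_lift_of_not_mem_mul hϖI h⟩

/-- res-L1-w45b-idea-1's stub, literally (with its — unnecessary — finiteness hypothesis): `Degenerate ϖ I := ϖ ∈ 𝔪·I`,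
`LiftIdeal ϖ I J := J ⊔ (ϖ) = I ∧ ϖ ∉ J`. OURS. [folklore] -/
theorem exists_liftIdeal_of_not_degenerate {I : Ideal A} (_hI : I.FG) {ϖ : A} (hϖI : ϖ ∈ I)
    (hnd : ¬ ϖ ∈ maximalIdeal A * I) : ∃ J : Ideal A, J ⊔ Ideal.span {ϖ} = I ∧ ϖ ∉ J := by
  obtain ⟨J, -, hϖJ, hJ⟩ := exists_flat_lift_of_not_mem_mul hϖI hnd
  exact ⟨J, hJ, hϖJ⟩

end LiftCore

end Summit.ResolutionOfSingularities.ResolutionOfSingularities.Cruxes.EquisingularLiftNat.Sections
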